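import Literature.IUT.HodgeArakelov.StableCurveAgreementDeltaIso
import HarnessLib

/-!
# [IUTchII] Rmk 2.3.1, second claim «the cuspidal inertia groups of `Π_v` are permuted by the conjugation action of `Π^cor_v`» AT THE GENUINE
# TOWER, from the instances of [CombGC] Prop 1.2 (ii) and of the `Π^cor_v`-stability of the `Π^±_v`-cuspidal family

S. Mochizuki, *Inter-universal Teichmüller Theory II*, kurims manuscript (Dec. 2020), §2, Remark 2.3.1 p. 69 l. 32–36: «In particular, [even though
`Π_v` (respectively, `Π̂_v`) fails to be normal in `Π^cor_v` (respectively, `Π̂^cor_v`)] it follows — since `Π^±_v` (respectively, `Π̂^±_v`) is normal in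
`Π^cor_v` (respectively, `Π̂^cor_v`) — that the cuspidal inertia groups of `Π_v` (respectively, `Π̂_v`) are permuted by the conjugation action of
`Π^cor_v` (respectively, `Π̂^cor_v`).» ([IUTchII] Rmk 2.3.1, kurims p.69) [cite: Mochizuki2012, II Rmk 2.3.1 p.69]; Def 2.3 (ii) p. 68
(group-theoreticity of the cuspidal inertia groups, [AbsTopI] Lem 4.5 / [CombGC] Prop 1.2 (ii)) [cite: MochizukiCombGC2007, Prop 1.2(ii) p.8].
abc-iut cell, node **IUTchII:Rmk2.3.1** (zone [IUTchII] §2; seat abc-iut-L6-t19 gen 6); PROOF-ONLY sequel of p444107 / p445460 / p446000.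

THE POINT.  abc-iut-L6-t19 gen 5 proved the second claim in the abstract (`isCuspidalInertia_map_conj_of_zHat`, p418082) from FIVE inline inputs:
the Def 2.3 (ii) statement of record `Def23_ii'`, normality and index of `Π_v ⊴ Π^±_v`, the `Ẑ(1)`-shape, total ramification, and the stability
`hsup` of the `Π^±_v`-cuspidal family under conjugation by the bigger group.  For the tempered triple `Π_v ⊆ Π^±_v ⊆ Π^cor_v` of a tower over the
print-level model and the cusp datum of an agreement with the [IUTchI] §2 datum of `X̲_v`, FOUR of the five are now THEOREMS (p445460 mod the
[CombGC] instance `hCT`; p429966; p429377; p443151; p444107), so the second claim holds GRANTED exactly the two FACT-class instances print itself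
invokes: `hCT` ([CombGC] Prop 1.2 (ii), F-0438) and `hsupC` — «conjugation by `Π^cor_v` permutes the cuspidal inertia groups OF `Π^±_v`» (the
group-theoreticity of cuspidal inertia groups under the automorphisms of `Π^tp_{X̲_v}` induced by `Π^tp_{C_v}`, [AbsTopI] Lem 4.5 / F-1704 class,
at the named instance).

* **`StableCurveAgreement.isCuspidalInertia_piV_conj_cor_genuine`** — for `g ∈ Π^cor_v` and `J` cuspidal in `Π_v`: `g J g⁻¹` is cuspidal in `Π_v`;
* **`rmk231_claim2_ofPiCHat`** — the package at the tower of record: `∃ Cu A` (p434636 clauses) with (`hCT` ∧ `hsupC`) → the second claim.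

HONEST LABEL: `hCT`, `hsupC` are hypotheses (FACT instances named above); other binders as in p444107.  Nothing of the series is asserted; no side
taken on [IUTchIII] Cor 3.12.
-/

noncomputable section

namespace Literature.IUT.HodgeArakelov

open Literature.AnabelianGeometry.EtaleTheta Literature.AnabelianGeometry.SemiGraphs Literature.IUT.HodgeTheaters
open Literature.AnabelianGeometry.AbsoluteAnabelian (IsCommensurablyTerminal)
open scoped Pointwise

namespace PlusMinusTower

section Genuine

variable {p : ℕ} [Fact p.Prime] {M : MuTwoSetting p}
  {E : M.toThetaSetting.EtaleThetaData} {l : ℕ} (C : E.DoubleUnderline l) {N : ℕ+}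
  (μ : M.toThetaSetting.CyclotomeMod l N) (hC : M.toThetaSetting.Compat) (hS : M.toThetaSetting.Sec2Hyps)
  (hl : l.Prime) (hp2 : p ≠ 2) (hpl : p ≠ l) (hζ : ∃ ζ : M.toThetaSetting.K, IsPrimitiveRoot ζ (4 * l))
  {η : (C.thetaEnvData μ hC hS).PiYdd → MuN p N} (hη : η ∈ (C.thetaEnvData μ hC hS).thetaCocycles)
  {P : TopGroup.{0}} {T : TemperedCoverings (BadPlaceSetting.ofUnderline C μ hC hS hl hp2 hpl hζ hη) P}
  (d : M.toTemperedCurve.GroupLevelData)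
  (Sfu : SpecialFibreData ((M.toThetaSetting.temperedCurveXuOfLevelData l C.l_ne_zero d).toTemperedArithmeticGroup
    (M.toThetaSetting.groupLevelDataXu l C.l_ne_zero d)))
  (h36u : Sfu.Gc.Prop36Hypotheses) (Sigmau SigmaHatu : Set ℕ) (hsubu : Sigmau ⊆ SigmaHatu) (hneu : Sigmau.Nonempty)
  (hprimeu : ∀ q ∈ SigmaHatu, q.Prime) (hpu : p ∉ Sigmau) (TpHu : Subgroup Sfu.chart.G)
  (HatHu : Subgroup (TemperedGraphGroupData.exists_completion_of_prop36 Sfu.Gc h36u Sfu.chart).choose)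
  (hleu : TpHu.map (TemperedGraphGroupData.exists_completion_of_prop36 Sfu.Gc h36u Sfu.chart).choose_spec.choose.toMonoidHom ≤ HatHu)
  (cuspu : {x : (M.toThetaSetting.temperedCurveXuOfLevelData l C.l_ne_zero d).Pt //
    (M.toThetaSetting.temperedCurveXuOfLevelData l C.l_ne_zero d).IsCusp x} → Prop)
  (hC3 : ∀ x : M.toTemperedCurve.Pt, M.toTemperedCurve.IsCusp x →
    (M.toTemperedCurve.inertia x).map M.toThetaSetting.toTheta = M.toThetaSetting.DeltaTheta)
  (hproper : M.toThetaSetting.lDeltaTheta l ≠ M.toThetaSetting.DeltaTheta)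

include hC3 hproper in
/-- **[IUTchII] Rmk 2.3.1, second claim, AT A GENUINE AGREEMENT** (kurims p. 69 «the cuspidal inertia groups of `Π_v` … are permuted by the
conjugation action of `Π^cor_v`»): for ANY tower `W` over a Prop 2.1 output of `BadPlaceSetting.ofUnderline` (`Π̂^cor_v` Hausdorff, `emb` continuous)
and the cusp datum of an agreement with the [IUTchI] §2 datum of `X̲_v` (p434636 clauses), conjugation by any `g ∈ Π^cor_v` carries cuspidal
inertia groups of `Π_v` to cuspidal inertia groups of `Π_v` — abc-iut-L6-t19's `isCuspidalInertia_map_conj_of_zHat` (p418082) with its inputs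
supplied BY NAME: `Def23_ii'` (p445460, mod `hCT`), normality (p429966), index (p429377), `Ẑ`-shape (p443151), total ramification (p444107);
GRANTED the two FACT instances `hCT` ([CombGC] Prop 1.2 (ii), F-0438) and `hsupC` («`Π^cor_v` permutes the cuspidal inertia groups of `Π^±_v`»,
[AbsTopI] Lem 4.5 / F-1704 class).  PROVED. ([IUTchII] Rmk 2.3.1, kurims p.69) [cite: Mochizuki2012, II Rmk 2.3.1 p.69]
[claim: Mochizuki2012, status: disputed] -/
theorem StableCurveAgreement.isCuspidalInertia_piV_conj_cor_genuine (hN : (C.Huu.subgroupOf (M.GtpXu l)).Normal)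
    (W : PlusMinusTower T) [T2Space W.Corhat] (hemb : Continuous W.emb) {Cu : CuspidalInertiaData W}
    (A : StableCurveAgreement W Cu
      (StableCurveTemperedData.ofSpecialFibre (M.toThetaSetting.temperedCurveXuOfLevelData l C.l_ne_zero d)
        (M.toThetaSetting.groupLevelDataXu l C.l_ne_zero d) Sfu h36u Sigmau SigmaHatu hsubu hneu hprimeu hpu TpHu HatHu hleu cuspu))
    (hA : ∀ x : T.Xplain, A.eHat ⟨W.emb x, W.emb_le_pmHat ⟨x, rfl⟩⟩ =
      (StableCurveTemperedData.ofSpecialFibre (M.toThetaSetting.temperedCurveXuOfLevelData l C.l_ne_zero d)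
        (M.toThetaSetting.groupLevelDataXu l C.l_ne_zero d) Sfu h36u Sigmau SigmaHatu hsubu hneu hprimeu hpu TpHu HatHu hleu cuspu).ιX
        (T.plainIso x))
    (hlev : ∀ (Q I : Subgroup W.Corhat), Cu.IsCuspidalInertia Q I ↔
      I ≤ Q ∧ ∃ I₀ : Subgroup W.Corhat, Cu.IsCuspidalInertia W.piPM I₀ ∧ I = I₀ ⊓ Q)
    (hCT : ∀ I' : Subgroup W.Corhat, Cu.IsCuspidalInertia W.piPM I' →
      IsCommensurablyTerminal (I'.subgroupOf (W.piPM ⊓ W.deltaCorHat)))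
    (hsupC : ∀ g ∈ W.cor, ∀ I' : Subgroup W.Corhat, Cu.IsCuspidalInertia W.piPM I' →
      Cu.IsCuspidalInertia W.piPM (I'.map (MulAut.conj g).toMonoidHom))
    {g : W.Corhat} (hg : g ∈ W.cor) {J : Subgroup W.Corhat} (hJ : Cu.IsCuspidalInertia W.piV J) :
    Cu.IsCuspidalInertia W.piV (J.map (MulAut.conj g).toMonoidHom) :=
  isCuspidalInertia_map_conj_of_zHat Cu
    (StableCurveAgreement.def23_ii'_genuine C μ hC hS hl hp2 hpl hζ hη d Sfu h36u Sigmau SigmaHatu hsubu hneu hprimeu hpu TpHu HatHu hleu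
      cuspu hC3 hproper hN W hemb A hA hlev hCT)
    (W.piV_subgroupOf_piPM_normal_ofUnderline C μ hC hS hl hp2 hpl hζ hη hN)
    (W.index_piV_subgroupOf_piPM_ofUnderline_eq_l C μ hC hS hl hp2 hpl hζ hη)
    (fun _ hI => StableCurveAgreement.nonempty_equiv_zHat_of_isCuspidalInertia_piPM
      (M.toThetaSetting.temperedCurveXuOfLevelData l C.l_ne_zero d) (M.toThetaSetting.groupLevelDataXu l C.l_ne_zero d)
      Sfu h36u Sigmau SigmaHatu hsubu hneu hprimeu hpu TpHu HatHu hleu cuspu hemb A T.plainIso hA hI)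
    (fun _ hI => StableCurveAgreement.not_le_piV_of_isCuspidalInertia_piPM C μ hC hS hl hp2 hpl hζ hη d Sfu h36u Sigmau SigmaHatu
      hsubu hneu hprimeu hpu TpHu HatHu hleu cuspu hC3 hproper W A hA hI)
    hsupC hg hJ

include hC3 hproper in
/-- The same with `hCT` supplied from the CURVE side (`isCommensurablyTerminal_piPM_of_curve`, p446000): the [CombGC] Prop 1.2 (ii) instance stated
for the conjugates of the inertia groups of the cusps of `X̲_v` inside `Δ^temp_{X̲_v}`. ([IUTchII] Rmk 2.3.1, kurims p.69)
[cite: Mochizuki2012, II Rmk 2.3.1 p.69] [claim: Mochizuki2012, status: disputed] -/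
theorem StableCurveAgreement.isCuspidalInertia_piV_conj_cor_genuine_of_curve (hN : (C.Huu.subgroupOf (M.GtpXu l)).Normal)
    (W : PlusMinusTower T) [T2Space W.Corhat] (hemb : Continuous W.emb) {Cu : CuspidalInertiaData W}
    (A : StableCurveAgreement W Cu
      (StableCurveTemperedData.ofSpecialFibre (M.toThetaSetting.temperedCurveXuOfLevelData l C.l_ne_zero d)
        (M.toThetaSetting.groupLevelDataXu l C.l_ne_zero d) Sfu h36u Sigmau SigmaHatu hsubu hneu hprimeu hpu TpHu HatHu hleu cuspu))
    (hA : ∀ x : T.Xplain, A.eHat ⟨W.emb x, W.emb_le_pmHat ⟨x, rfl⟩⟩ =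
      (StableCurveTemperedData.ofSpecialFibre (M.toThetaSetting.temperedCurveXuOfLevelData l C.l_ne_zero d)
        (M.toThetaSetting.groupLevelDataXu l C.l_ne_zero d) Sfu h36u Sigmau SigmaHatu hsubu hneu hprimeu hpu TpHu HatHu hleu cuspu).ιX
        (T.plainIso x))
    (hlev : ∀ (Q I : Subgroup W.Corhat), Cu.IsCuspidalInertia Q I ↔
      I ≤ Q ∧ ∃ I₀ : Subgroup W.Corhat, Cu.IsCuspidalInertia W.piPM I₀ ∧ I = I₀ ⊓ Q)
    (hY : ∀ (y : (StableCurveTemperedData.ofSpecialFibre (M.toThetaSetting.temperedCurveXuOfLevelData l C.l_ne_zero d)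
        (M.toThetaSetting.groupLevelDataXu l C.l_ne_zero d) Sfu h36u Sigmau SigmaHatu hsubu hneu hprimeu hpu TpHu HatHu hleu cuspu).Cusp)
      (t : (M.toThetaSetting.temperedCurveXuOfLevelData l C.l_ne_zero d).PiTemp), IsCommensurablyTerminal ((MulAut.conj t •
        (((StableCurveTemperedData.ofSpecialFibre (M.toThetaSetting.temperedCurveXuOfLevelData l C.l_ne_zero d)
          (M.toThetaSetting.groupLevelDataXu l C.l_ne_zero d) Sfu h36u Sigmau SigmaHatu hsubu hneu hprimeu hpu TpHu HatHu hleu cuspu).inertiaTp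
          y).map
          (StableCurveTemperedData.ofSpecialFibre (M.toThetaSetting.temperedCurveXuOfLevelData l C.l_ne_zero d)
            (M.toThetaSetting.groupLevelDataXu l C.l_ne_zero d) Sfu h36u Sigmau SigmaHatu hsubu hneu hprimeu hpu TpHu HatHu hleu
            cuspu).DeltaTp.subtype)).subgroupOf
        (M.toThetaSetting.temperedCurveXuOfLevelData l C.l_ne_zero d).DeltaTemp))
    (hsupC : ∀ g ∈ W.cor, ∀ I' : Subgroup W.Corhat, Cu.IsCuspidalInertia W.piPM I' →
      Cu.IsCuspidalInertia W.piPM (I'.map (MulAut.conj g).toMonoidHom))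
    {g : W.Corhat} (hg : g ∈ W.cor) {J : Subgroup W.Corhat} (hJ : Cu.IsCuspidalInertia W.piV J) :
    Cu.IsCuspidalInertia W.piV (J.map (MulAut.conj g).toMonoidHom) :=
  StableCurveAgreement.isCuspidalInertia_piV_conj_cor_genuine C μ hC hS hl hp2 hpl hζ hη d Sfu h36u Sigmau SigmaHatu hsubu hneu hprimeu
    hpu TpHu HatHu hleu cuspu hC3 hproper hN W hemb A hA hlev
    (fun _ hI' => StableCurveAgreement.isCommensurablyTerminal_piPM_of_curve
      (M.toThetaSetting.temperedCurveXuOfLevelData l C.l_ne_zero d) (M.toThetaSetting.groupLevelDataXu l C.l_ne_zero d)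
      Sfu h36u Sigmau SigmaHatu hsubu hneu hprimeu hpu TpHu HatHu hleu cuspu W A T.plainIso hA hY hI')
    hsupC hg hJ

end Genuine

end PlusMinusTower

end Literature.IUT.HodgeArakelov

end
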